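import Mathlib
import Summits.MatrixMultiplication.MatrixMultiplication.Theorems.SubgroupIdentityDesigns.Negative.WitnessShell
import Summits.MatrixMultiplication.MatrixMultiplication.Theorems.SubgroupIdentityDesigns.Negative.LevelOneClassification

/-!
# The level-one witness shell, explicitly: `(1 + a² + (p−2)b²)³ < p^{3ε/(2+ε)} · V²`, hence `p^(6l−1) < V²`
# (support lemma for stmt-MatrixMultiplication-14079; cell B2b-5 `b2b-lgcu-borel`, gen 11 —
# report `run/shared/lean/b2b/levelgraded-cu/ORACLE-g11.md` §G11-1b)

`WitnessShell.crux_shell` says every witness of the crux satisfies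
`(dim F_k|_G)³ < #(Irr(G) ∩ F_k)^{3ε/(2+ε)} · V²`.  At level one in `G = GL_{1+l}(𝔽_p)` (`l ≥ 1`)
both quantities are known EXACTLY (`LevelOneClassification.finrank_levelOne_eq`: `dim F_1|_G =
1 + a² + (p−2)b²`, `a = (p^{1+l} − p)/(p − 1)`, `b = (p^{1+l} − 1)/(p − 1)`; `ncard_irr_levelOne`:
exactly `p` irreducible characters), so:

* `levelOne_shell` — every level-one witness has `(1 + a² + (p−2)b²)³ < p^{3ε/(2+ε)} · V²`;
* `levelOne_volume_floor` — for `0 < ε ≤ 1`: `p^(6l−1) < V²` (from `a ≥ p^l` and `3ε/(2+ε) ≤ 1`),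
  i.e. a level-one identity design serving the crux needs volume `V > p^{3l − 1/2}`; together with the
  wall `2V² ≤ (dim F_1|_G)³ = O(p^{6l+3})` the level-one shell is `V = p^{3l + O(1)}` — while the
  level-one designs actually found (ORACLE-g11 §G11-4) have `V ≤ 1.2 · dim F_1|_G = O(p^{2l+1})`.

Sorry-free; standard axioms.  VALUE = theorem (explicit necessary condition on witnesses), NOT summit
progress; the crux item stays open.
-/

set_option linter.dupNamespace false

open scoped BigOperators Classical Matrix
open Module Literature.RepresentationTheory.FiniteGroups
open Literature.Barriers.MatrixMultiplication (SubgroupTPP)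
open Summit.MatrixMultiplication.MatrixMultiplication.Theorems.LieRankDesigns.Negative
  (GLm Mat levelSet budget)

namespace Summit.MatrixMultiplication.MatrixMultiplication.Theorems.SubgroupIdentityDesigns.Negative
namespace LevelOneShell

open WitnessShell (crux_shell)
open LevelOneClassification (finrank_levelOne_eq ncard_irr_levelOne)

variable {p : ℕ} [hp : Fact p.Prime] {l : ℕ}

/-- **The level-one shell, explicitly**: every level-one witness of the crux in `GL_{1+l}(𝔽_p)`
(`l ≥ 1`) has `(1 + a² + (p−2)b²)³ < p^{3ε/(2+ε)} · V²`. -/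
theorem levelOne_shell (hl : 1 ≤ l) {ε : ℝ} (hε : 0 < ε) {H₁ H₂ H₃ : Subgroup (GLm p (1 + l))}
    (htpp : SubgroupTPP H₁ H₂ H₃)
    (hdes : ∃ c : Mat p (1 + l) → ℂ, (∀ M, 1 < M.rank → c M = 0) ∧
      (∑ M, c M * ZMod.stdAddChar
        (Matrix.trace (M * ((1 : GLm p (1 + l)) : Mat p (1 + l))))) = 1 ∧
      ∀ a ∈ H₁, ∀ b ∈ H₂, ∀ g ∈ H₃, a * b * g ≠ 1 →
        (∑ M, c M * ZMod.stdAddChar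
          (Matrix.trace (M * ((a * b * g : GLm p (1 + l)) : Mat p (1 + l))))) = 0)
    (hlt : budget p (1 + l) 1 (2 + ε) <
      ((Nat.card H₁ * Nat.card H₂ * Nat.card H₃ : ℕ) : ℝ) ^ ((2 + ε) / 3)) :
    (1 + (((p : ℝ) ^ (1 + l) - p) / ((p : ℝ) - 1)) ^ 2 +
        ((p : ℝ) - 2) * (((p : ℝ) ^ (1 + l) - 1) / ((p : ℝ) - 1)) ^ 2) ^ 3 <
      (p : ℝ) ^ (3 * ε / (2 + ε)) * ((Nat.card H₁ * Nat.card H₂ * Nat.card H₃ : ℕ) : ℝ) ^ 2 := by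
  have h := crux_shell (p := p) (m := 1 + l) (k := 1) hε htpp hdes hlt
  rw [finrank_levelOne_eq hl, ncard_irr_levelOne hl] at h
  exact h

/-- **Level-one volume floor**: for `0 < ε ≤ 1`, every level-one witness of the crux in
`GL_{1+l}(𝔽_p)` (`l ≥ 1`) has `p^(6l−1) < V²` (so `V > p^{3l − 1/2}`). -/
theorem levelOne_volume_floor (hl : 1 ≤ l) {ε : ℝ} (hε : 0 < ε) (hε1 : ε ≤ 1)
    {H₁ H₂ H₃ : Subgroup (GLm p (1 + l))}
    (htpp : SubgroupTPP H₁ H₂ H₃)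
    (hdes : ∃ c : Mat p (1 + l) → ℂ, (∀ M, 1 < M.rank → c M = 0) ∧
      (∑ M, c M * ZMod.stdAddChar
        (Matrix.trace (M * ((1 : GLm p (1 + l)) : Mat p (1 + l))))) = 1 ∧
      ∀ a ∈ H₁, ∀ b ∈ H₂, ∀ g ∈ H₃, a * b * g ≠ 1 →
        (∑ M, c M * ZMod.stdAddChar
          (Matrix.trace (M * ((a * b * g : GLm p (1 + l)) : Mat p (1 + l))))) = 0)
    (hlt : budget p (1 + l) 1 (2 + ε) <
      ((Nat.card H₁ * Nat.card H₂ * Nat.card H₃ : ℕ) : ℝ) ^ ((2 + ε) / 3)) :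
    (p : ℝ) ^ (6 * l - 1) < ((Nat.card H₁ * Nat.card H₂ * Nat.card H₃ : ℕ) : ℝ) ^ 2 := by
  have h := levelOne_shell hl hε htpp hdes hlt
  set V : ℝ := ((Nat.card H₁ * Nat.card H₂ * Nat.card H₃ : ℕ) : ℝ) with hV
  set a : ℝ := ((p : ℝ) ^ (1 + l) - p) / ((p : ℝ) - 1) with ha
  set b : ℝ := ((p : ℝ) ^ (1 + l) - 1) / ((p : ℝ) - 1) with hb
  have hp2 : (2 : ℝ) ≤ p := by exact_mod_cast hp.out.two_le
  have hp0 : (0 : ℝ) < p := by linarith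
  have hp1 : (0 : ℝ) < (p : ℝ) - 1 := by linarith
  -- `p^l ≤ a`
  have hpl : (p : ℝ) ≤ (p : ℝ) ^ l := by
    calc (p : ℝ) = (p : ℝ) ^ 1 := (pow_one _).symm
      _ ≤ (p : ℝ) ^ l := pow_le_pow_right₀ (by linarith) hl
  have ha_ge : (p : ℝ) ^ l ≤ a := by
    rw [ha, le_div_iff₀ hp1]
    have : (p : ℝ) ^ (1 + l) = p * (p : ℝ) ^ l := by ring
    rw [this]; nlinarith
  have hpl0 : (0 : ℝ) ≤ (p : ℝ) ^ l := by positivity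
  -- `p^(2l) ≤ 1 + a² + (p-2) b²`
  have hD : ((p : ℝ) ^ l) ^ 2 ≤ 1 + a ^ 2 + ((p : ℝ) - 2) * b ^ 2 := by
    have h1 : ((p : ℝ) ^ l) ^ 2 ≤ a ^ 2 := pow_le_pow_left₀ hpl0 ha_ge 2
    have h2 : (0 : ℝ) ≤ ((p : ℝ) - 2) * b ^ 2 := mul_nonneg (by linarith) (sq_nonneg _)
    linarith
  have hD3 : (((p : ℝ) ^ l) ^ 2) ^ 3 ≤ (1 + a ^ 2 + ((p : ℝ) - 2) * b ^ 2) ^ 3 :=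
    pow_le_pow_left₀ (by positivity) hD 3
  -- `p^{3ε/(2+ε)} ≤ p`
  have hexp : 3 * ε / (2 + ε) ≤ 1 := by
    rw [div_le_one (by linarith)]; linarith
  have hpe : (p : ℝ) ^ (3 * ε / (2 + ε)) ≤ p := by
    calc (p : ℝ) ^ (3 * ε / (2 + ε)) ≤ (p : ℝ) ^ (1 : ℝ) :=
          Real.rpow_le_rpow_of_exponent_le (by linarith) hexp
      _ = p := Real.rpow_one _
  have hV0 : (0 : ℝ) ≤ V ^ 2 := sq_nonneg _
  have hchain : (((p : ℝ) ^ l) ^ 2) ^ 3 < p * V ^ 2 :=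
    (hD3.trans_lt h).trans_le (mul_le_mul_of_nonneg_right hpe hV0)
  have hpow : (((p : ℝ) ^ l) ^ 2) ^ 3 = (p : ℝ) ^ (6 * l - 1) * p := by
    rw [← pow_mul, ← pow_mul, ← pow_succ]
    congr 1; omega
  rw [hpow, mul_comm (p : ℝ) (V ^ 2)] at hchain
  exact lt_of_mul_lt_mul_right hchain hp0.le
end LevelOneShell
end Summit.MatrixMultiplication.MatrixMultiplication.Theorems.SubgroupIdentityDesigns.Negative
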